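import Summits.Parity.BatemanHorn.Theorems.SoloInformedTwinFarTailTiers
import Summits.Parity.BatemanHorn.Theorems.SoloInformedTwinFarTailCofactors

/-!
# SoloInformedTwinFarTailChowla — what a uniform two-point Chowla bound over the dilations buys:
# the sufficiency half of the far-tail statement, typed

Solo unit `solo-Parity-informed` (ideation tier, informed mode), session 48; `paper.md` §20
(Remark 20.13), `SHARPEST-STATEMENT.md` §2 Theorem F / §4L, CLAIMS C128.

`SoloInformedTwinBalancedSplit` (C120): under the typed prose inputs (F′) `U = o(x)` and (F)
`W = o(x)`, the Hardy–Littlewood twin asymptotic holds iff the BALANCED FAR TAIL `R(x) = o(x)`.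
`SoloInformedTwinFarTailCofactors` (C126): `R = ∑_{m₁ ≤ x/(z+1), m₂ ≤ (x+2)/(z+1)} C(m₁,m₂)`, where
`C(m₁,m₂) = twinCofactorTerm` is a two-point Möbius correlation with `log²` weight along the
progressions `n ≡ 0 (m₁)`, `n ≡ -2 (m₂)` (dilated pair-Chowla; the corner `(1,1)` is
`∑ μ(n)μ(n+2) log²(n(n+2))`), and `C(m₁,m₂) = 0` once `(Y+1)m₁m₂ > x(x+2)`.
`SoloInformedTwinFarTailTiers` (C125): the three tiers of the twin prime problem read on `R`.

This file types the SUFFICIENCY direction per dilation — pure bookkeeping, no analytic input: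

* `abs_twinCofactorTerm_le` — the trivial size: `|C(m₁,m₂)| ≤ (2 log(x+2))² · N(m₁,m₂;x)` with
  `N = twinPairCount` (`= x/(m₁m₂) + O(1)` on admissible pairs, C117);
* `abs_twinBalancedFarSum_le_sum_of_cofactor_bound` (and one-sided forms) — per-pair bounds on the
  effective range sum to a bound for `R`;
* `sum_Icc_sum_Icc_one_div_mul_le` — `∑∑ 1/(m₁m₂) = H·H ≤ (1 + log A)(1 + log B)`;
* `abs_twinBalancedFarSum_le_of_uniform_cofactor_bound` — if EVERY dilated correlation on the
  effective range satisfies `|C(m₁,m₂)| ≤ δx / (m₁m₂ (1 + log(x+2))²)`, then `|R(x)| ≤ δx`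
  (a saving of `≍ δ (log x)^{-4}` against the trivial size, uniformly over `≍ x^{1-η} log x` pairs);
* `twinBalancedFarSum_isLittleO_of_uniform_cofactor_bound` — the same for every `δ > 0`
  eventually gives `R = o(x)`;
* `hardyLittlewood_of_uniform_cofactor_bound` — hence, under (F′), (F), the Hardy–Littlewood
  twin asymptotic `π₂(x) ~ 2C₂x/log²x`;
* `twinPrimeConjecture_of_frequently_cofactor_lower` — and a ONE-SIDED version at tier 1: under
  (F′), (F), if for some fixed `0 ≤ δ < 4C₂` and infinitely many `x` every dilated correlation
  satisfies `C(m₁,m₂) ≥ -δx / (m₁m₂(1 + log(x+2))²)`, there are infinitely many twin primes.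

The converse direction is NOT claimed: `R = o(x)` does not force the individual `C(m₁,m₂)` to be
small.  Nothing here bears on (F′), (F), which remain prose (paper.md §20).
-/

namespace Summit.Parity.BatemanHorn.Theorems

open Finset Filter Asymptotics ArithmeticFunction
open scoped ArithmeticFunction.Moebius Topology
open Literature.NumberTheory.Sieve

/-! ### 1. The trivial size of one dilated correlation -/

/-- `|w(e₁,e₂)| ≤ log²(e₁e₂)` for the far-tail weight. -/
theorem abs_twinFarWeight_le (y z Y e₁ e₂ : ℕ) :
    |twinFarWeight y z Y e₁ e₂| ≤ Real.log ((e₁ * e₂ : ℕ) : ℝ) ^ 2 := by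
  have hL : 0 ≤ Real.log ((e₁ * e₂ : ℕ) : ℝ) ^ 2 := sq_nonneg _
  unfold twinFarWeight
  split_ifs
  · rw [abs_mul, abs_mul, abs_of_nonneg hL]
    have h1 : |(μ e₁ : ℝ)| ≤ 1 := by exact_mod_cast abs_moebius_le_one
    have h2 : |(μ e₂ : ℝ)| ≤ 1 := by exact_mod_cast abs_moebius_le_one
    calc |(μ e₁ : ℝ)| * |(μ e₂ : ℝ)| * Real.log ((e₁ * e₂ : ℕ) : ℝ) ^ 2
        ≤ 1 * 1 * Real.log ((e₁ * e₂ : ℕ) : ℝ) ^ 2 := by gcongr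
      _ = Real.log ((e₁ * e₂ : ℕ) : ℝ) ^ 2 := by ring
  · rw [abs_zero]; exact hL
  · rw [abs_zero]; exact hL

/-- On `e₁, e₂ ≤ x + 2` the weight is at most `(2 log(x+2))²`. -/
theorem abs_twinFarWeight_le_of_le {x e₁ e₂ : ℕ} (y z Y : ℕ) (h₁ : e₁ ≤ x + 2)
    (h₂ : e₂ ≤ x + 2) :
    |twinFarWeight y z Y e₁ e₂| ≤ (2 * Real.log ((x : ℝ) + 2)) ^ 2 := by
  refine (abs_twinFarWeight_le y z Y e₁ e₂).trans ?_
  have hx0 : (0 : ℝ) ≤ x := Nat.cast_nonneg x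
  have h0 : 0 ≤ Real.log ((e₁ * e₂ : ℕ) : ℝ) := Real.log_natCast_nonneg _
  have hle : Real.log ((e₁ * e₂ : ℕ) : ℝ) ≤ 2 * Real.log ((x : ℝ) + 2) := by
    rcases Nat.eq_zero_or_pos (e₁ * e₂) with h | h
    · rw [h, Nat.cast_zero, Real.log_zero]
      have := Real.log_nonneg (show (1 : ℝ) ≤ (x : ℝ) + 2 by linarith)
      linarith
    · have hprod : ((e₁ * e₂ : ℕ) : ℝ) ≤ ((x : ℝ) + 2) ^ 2 := by
        have hm : e₁ * e₂ ≤ (x + 2) * (x + 2) := Nat.mul_le_mul h₁ h₂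
        calc ((e₁ * e₂ : ℕ) : ℝ) ≤ (((x + 2) * (x + 2) : ℕ) : ℝ) := by exact_mod_cast hm
          _ = ((x : ℝ) + 2) ^ 2 := by push_cast; ring
      calc Real.log ((e₁ * e₂ : ℕ) : ℝ) ≤ Real.log (((x : ℝ) + 2) ^ 2) :=
            Real.log_le_log (by exact_mod_cast h) hprod
        _ = 2 * Real.log ((x : ℝ) + 2) := by rw [Real.log_pow]; norm_num
  exact pow_le_pow_left₀ h0 hle 2

/-- **Trivial size of a dilated correlation:** `|C(m₁,m₂)| ≤ (2 log(x+2))² · N(m₁,m₂;x)`, where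
`N = twinPairCount` counts the two progressions (`= x/(m₁m₂) + O(1)` on admissible pairs, C117). -/
theorem abs_twinCofactorTerm_le (x y z Y m₁ m₂ : ℕ) :
    |twinCofactorTerm x y z Y m₁ m₂|
      ≤ (2 * Real.log ((x : ℝ) + 2)) ^ 2 * twinPairCount x m₁ m₂ := by
  set Wx : ℝ := (2 * Real.log ((x : ℝ) + 2)) ^ 2 with hWx
  have hS₁ : |∑ n ∈ ((Icc 1 x).filter Odd) with (m₁ ∣ n ∧ m₂ ∣ n + 2),
        twinFarWeight y z Y (n / m₁) ((n + 2) / m₂)|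
      ≤ (#(((Icc 1 x).filter Odd).filter (fun n => m₁ ∣ n ∧ m₂ ∣ n + 2)) : ℝ) * Wx := by
    refine (abs_sum_le_sum_abs _ _).trans ?_
    have h := Finset.sum_le_card_nsmul
      (((Icc 1 x).filter Odd).filter (fun n => m₁ ∣ n ∧ m₂ ∣ n + 2))
      (fun n => |twinFarWeight y z Y (n / m₁) ((n + 2) / m₂)|) Wx (fun n hn => by
        simp only [mem_filter, mem_Icc] at hn
        obtain ⟨⟨⟨-, hnx⟩, -⟩, -⟩ := hn
        exact abs_twinFarWeight_le_of_le y z Y ((Nat.div_le_self _ _).trans (by omega))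
          ((Nat.div_le_self _ _).trans (by omega)))
    rwa [nsmul_eq_mul] at h
  have hS₂ : |∑ m ∈ (Icc 1 (x / 2)) with (m₁ ∣ m ∧ m₂ ∣ m + 1),
        twinFarWeight y z Y (m / m₁) ((m + 1) / m₂)|
      ≤ (#((Icc 1 (x / 2)).filter (fun m => m₁ ∣ m ∧ m₂ ∣ m + 1)) : ℝ) * Wx := by
    refine (abs_sum_le_sum_abs _ _).trans ?_
    have h := Finset.sum_le_card_nsmul
      ((Icc 1 (x / 2)).filter (fun m => m₁ ∣ m ∧ m₂ ∣ m + 1))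
      (fun m => |twinFarWeight y z Y (m / m₁) ((m + 1) / m₂)|) Wx (fun m hm => by
        simp only [mem_filter, mem_Icc] at hm
        obtain ⟨⟨-, hmx⟩, -⟩ := hm
        exact abs_twinFarWeight_le_of_le y z Y ((Nat.div_le_self _ _).trans (by omega))
          ((Nat.div_le_self _ _).trans (by omega)))
    rwa [nsmul_eq_mul] at h
  have key : |twinCofactorTerm x y z Y m₁ m₂|
      ≤ (#(((Icc 1 x).filter Odd).filter (fun n => m₁ ∣ n ∧ m₂ ∣ n + 2)) : ℝ) * Wx
        + (#((Icc 1 (x / 2)).filter (fun m => m₁ ∣ m ∧ m₂ ∣ m + 1)) : ℝ) * Wx := by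
    unfold twinCofactorTerm
    exact (abs_add_le _ _).trans (add_le_add hS₁ hS₂)
  calc |twinCofactorTerm x y z Y m₁ m₂|
      ≤ (#(((Icc 1 x).filter Odd).filter (fun n => m₁ ∣ n ∧ m₂ ∣ n + 2)) : ℝ) * Wx
        + (#((Icc 1 (x / 2)).filter (fun m => m₁ ∣ m ∧ m₂ ∣ m + 1)) : ℝ) * Wx := key
    _ = Wx * twinPairCount x m₁ m₂ := by unfold twinPairCount; ring

/-! ### 2. Per-pair bounds on the effective range sum to bounds for `R` -/

/-- Two-sided: `|C(m₁,m₂)| ≤ B(m₁,m₂)` on the effective range (`m₁ ≤ x/(z+1)`, `m₂ ≤ (x+2)/(z+1)`,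
`(Y+1)m₁m₂ ≤ x(x+2)`) and `B ≥ 0` give `|R| ≤ ∑∑ B`. -/
theorem abs_twinBalancedFarSum_le_sum_of_cofactor_bound (x y z Y : ℕ) {B : ℕ → ℕ → ℝ}
    (hB0 : ∀ m₁ m₂, 0 ≤ B m₁ m₂)
    (hB : ∀ m₁ ∈ Icc 1 (x / (z + 1)), ∀ m₂ ∈ Icc 1 ((x + 2) / (z + 1)),
      (Y + 1) * (m₁ * m₂) ≤ x * (x + 2) → |twinCofactorTerm x y z Y m₁ m₂| ≤ B m₁ m₂) :
    |twinBalancedFarSum x y z Y|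
      ≤ ∑ m₁ ∈ Icc 1 (x / (z + 1)), ∑ m₂ ∈ Icc 1 ((x + 2) / (z + 1)), B m₁ m₂ := by
  rw [twinBalancedFarSum_eq_sum_cofactorTerm_range]
  refine (abs_sum_le_sum_abs _ _).trans (sum_le_sum fun m₁ hm₁ => ?_)
  refine (abs_sum_le_sum_abs _ _).trans (sum_le_sum fun m₂ hm₂ => ?_)
  by_cases h : (Y + 1) * (m₁ * m₂) ≤ x * (x + 2)
  · exact hB m₁ hm₁ m₂ hm₂ h
  · rw [twinCofactorTerm_eq_zero_of_lt_mul_mul (not_le.mp h), abs_zero]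
    exact hB0 m₁ m₂

/-- One-sided, lower: `C(m₁,m₂) ≥ -B(m₁,m₂)` on the effective range and `B ≥ 0` give `R ≥ -∑∑ B`. -/
theorem neg_sum_le_twinBalancedFarSum_of_cofactor_lower (x y z Y : ℕ) {B : ℕ → ℕ → ℝ}
    (hB0 : ∀ m₁ m₂, 0 ≤ B m₁ m₂)
    (hB : ∀ m₁ ∈ Icc 1 (x / (z + 1)), ∀ m₂ ∈ Icc 1 ((x + 2) / (z + 1)),
      (Y + 1) * (m₁ * m₂) ≤ x * (x + 2) → -B m₁ m₂ ≤ twinCofactorTerm x y z Y m₁ m₂) :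
    -(∑ m₁ ∈ Icc 1 (x / (z + 1)), ∑ m₂ ∈ Icc 1 ((x + 2) / (z + 1)), B m₁ m₂)
      ≤ twinBalancedFarSum x y z Y := by
  rw [twinBalancedFarSum_eq_sum_cofactorTerm_range, ← sum_neg_distrib]
  refine sum_le_sum fun m₁ hm₁ => ?_
  rw [← sum_neg_distrib]
  refine sum_le_sum fun m₂ hm₂ => ?_
  by_cases h : (Y + 1) * (m₁ * m₂) ≤ x * (x + 2)
  · exact hB m₁ hm₁ m₂ hm₂ h
  · rw [twinCofactorTerm_eq_zero_of_lt_mul_mul (not_le.mp h)]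
    exact neg_nonpos.mpr (hB0 m₁ m₂)

/-- One-sided, upper: `C(m₁,m₂) ≤ B(m₁,m₂)` on the effective range and `B ≥ 0` give `R ≤ ∑∑ B`. -/
theorem twinBalancedFarSum_le_sum_of_cofactor_upper (x y z Y : ℕ) {B : ℕ → ℕ → ℝ}
    (hB0 : ∀ m₁ m₂, 0 ≤ B m₁ m₂)
    (hB : ∀ m₁ ∈ Icc 1 (x / (z + 1)), ∀ m₂ ∈ Icc 1 ((x + 2) / (z + 1)),
      (Y + 1) * (m₁ * m₂) ≤ x * (x + 2) → twinCofactorTerm x y z Y m₁ m₂ ≤ B m₁ m₂) :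
    twinBalancedFarSum x y z Y
      ≤ ∑ m₁ ∈ Icc 1 (x / (z + 1)), ∑ m₂ ∈ Icc 1 ((x + 2) / (z + 1)), B m₁ m₂ := by
  rw [twinBalancedFarSum_eq_sum_cofactorTerm_range]
  refine sum_le_sum fun m₁ hm₁ => sum_le_sum fun m₂ hm₂ => ?_
  by_cases h : (Y + 1) * (m₁ * m₂) ≤ x * (x + 2)
  · exact hB m₁ hm₁ m₂ hm₂ h
  · rw [twinCofactorTerm_eq_zero_of_lt_mul_mul (not_le.mp h)]
    exact hB0 m₁ m₂

/-! ### 3. The harmonic normalisation -/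

/-- `∑_{m₁ ≤ A} ∑_{m₂ ≤ B} 1/(m₁m₂) = H_A H_B ≤ (1 + log A)(1 + log B)`. -/
theorem sum_Icc_sum_Icc_one_div_mul_le (A B : ℕ) :
    ∑ m₁ ∈ Icc 1 A, ∑ m₂ ∈ Icc 1 B, (1 : ℝ) / ((m₁ : ℝ) * m₂)
      ≤ (1 + Real.log A) * (1 + Real.log B) := by
  have hH : ∀ N : ℕ, ∑ m ∈ Icc 1 N, (1 : ℝ) / m = (harmonic N : ℝ) := fun N => by
    rw [harmonic_eq_sum_Icc]
    push_cast
    exact sum_congr rfl fun m _ => one_div _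
  have hle : ∀ N : ℕ, ∑ m ∈ Icc 1 N, (1 : ℝ) / m ≤ 1 + Real.log N := fun N => by
    rw [hH]
    exact harmonic_le_one_add_log N
  have hnn : ∀ N : ℕ, 0 ≤ ∑ m ∈ Icc 1 N, (1 : ℝ) / m := fun N =>
    sum_nonneg fun m _ => by positivity
  calc ∑ m₁ ∈ Icc 1 A, ∑ m₂ ∈ Icc 1 B, (1 : ℝ) / ((m₁ : ℝ) * m₂)
      = (∑ m₁ ∈ Icc 1 A, (1 : ℝ) / m₁) * ∑ m₂ ∈ Icc 1 B, (1 : ℝ) / m₂ := by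
        rw [sum_mul]
        refine sum_congr rfl fun m₁ _ => ?_
        rw [mul_sum]
        refine sum_congr rfl fun m₂ _ => ?_
        rw [one_div_mul_one_div]
    _ ≤ (1 + Real.log A) * (1 + Real.log B) :=
        mul_le_mul (hle A) (hle B) (hnn B) ((hnn A).trans (hle A))

/-- The normalised double sum over the cofactor range is at most `δx`:
`∑_{m₁ ≤ x/(z+1)} ∑_{m₂ ≤ (x+2)/(z+1)} δx / (m₁m₂(1 + log(x+2))²) ≤ δx`. -/
theorem sum_cofactorRange_normalised_le (x z : ℕ) {δ : ℝ} (hδ : 0 ≤ δ) :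
    ∑ m₁ ∈ Icc 1 (x / (z + 1)), ∑ m₂ ∈ Icc 1 ((x + 2) / (z + 1)),
        δ * x / (((m₁ : ℝ) * m₂) * (1 + Real.log ((x : ℝ) + 2)) ^ 2) ≤ δ * x := by
  set L : ℝ := 1 + Real.log ((x : ℝ) + 2) with hLdef
  have hx0 : (0 : ℝ) ≤ x := Nat.cast_nonneg x
  have hlog0 : 0 ≤ Real.log ((x : ℝ) + 2) := Real.log_nonneg (by linarith)
  have hL1 : 1 ≤ L := by rw [hLdef]; linarith
  have hL0 : 0 < L := by linarith
  have hlogle : ∀ N : ℕ, N ≤ x + 2 → 1 + Real.log (N : ℝ) ≤ L := by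
    intro N hN
    rcases Nat.eq_zero_or_pos N with h | h
    · rw [h, Nat.cast_zero, Real.log_zero, hLdef]; linarith
    · have hN' : (N : ℝ) ≤ (x : ℝ) + 2 := by exact_mod_cast hN
      have := Real.log_le_log (by exact_mod_cast h) hN'
      rw [hLdef]; linarith
  have hA : 1 + Real.log ((x / (z + 1) : ℕ) : ℝ) ≤ L :=
    hlogle _ ((Nat.div_le_self _ _).trans (Nat.le_add_right _ _))
  have hB : 1 + Real.log (((x + 2) / (z + 1) : ℕ) : ℝ) ≤ L := hlogle _ (Nat.div_le_self _ _)
  have hB0 : 0 ≤ 1 + Real.log (((x + 2) / (z + 1) : ℕ) : ℝ) := by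
    have := Real.log_natCast_nonneg ((x + 2) / (z + 1)); linarith
  have hδx : 0 ≤ δ * x / L ^ 2 := div_nonneg (mul_nonneg hδ hx0) (sq_nonneg L)
  calc ∑ m₁ ∈ Icc 1 (x / (z + 1)), ∑ m₂ ∈ Icc 1 ((x + 2) / (z + 1)),
          δ * x / (((m₁ : ℝ) * m₂) * L ^ 2)
      = δ * x / L ^ 2 * ∑ m₁ ∈ Icc 1 (x / (z + 1)), ∑ m₂ ∈ Icc 1 ((x + 2) / (z + 1)),
          (1 : ℝ) / ((m₁ : ℝ) * m₂) := by
        rw [mul_sum]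
        refine sum_congr rfl fun m₁ hm₁ => ?_
        rw [mul_sum]
        refine sum_congr rfl fun m₂ hm₂ => ?_
        have h1 : (0 : ℝ) < m₁ := by exact_mod_cast (mem_Icc.mp hm₁).1
        have h2 : (0 : ℝ) < m₂ := by exact_mod_cast (mem_Icc.mp hm₂).1
        field_simp
    _ ≤ δ * x / L ^ 2 * ((1 + Real.log ((x / (z + 1) : ℕ) : ℝ))
          * (1 + Real.log (((x + 2) / (z + 1) : ℕ) : ℝ))) :=
        mul_le_mul_of_nonneg_left (sum_Icc_sum_Icc_one_div_mul_le _ _) hδx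
    _ ≤ δ * x / L ^ 2 * (L * L) :=
        mul_le_mul_of_nonneg_left (mul_le_mul hA hB hB0 hL0.le) hδx
    _ = δ * x := by field_simp

/-! ### 4. Sufficiency, pointwise in `x` -/

/-- **Uniform dilated pair-Chowla bounds the far tail.**  If every dilated correlation on the
effective range satisfies `|C(m₁,m₂)| ≤ δx / (m₁m₂(1 + log(x+2))²)`, then `|R(x)| ≤ δx`. -/
theorem abs_twinBalancedFarSum_le_of_uniform_cofactor_bound (x y z Y : ℕ) {δ : ℝ} (hδ : 0 ≤ δ)
    (hC : ∀ m₁ ∈ Icc 1 (x / (z + 1)), ∀ m₂ ∈ Icc 1 ((x + 2) / (z + 1)),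
      (Y + 1) * (m₁ * m₂) ≤ x * (x + 2) →
      |twinCofactorTerm x y z Y m₁ m₂|
        ≤ δ * x / (((m₁ : ℝ) * m₂) * (1 + Real.log ((x : ℝ) + 2)) ^ 2)) :
    |twinBalancedFarSum x y z Y| ≤ δ * x := by
  have hx0 : (0 : ℝ) ≤ x := Nat.cast_nonneg x
  refine (abs_twinBalancedFarSum_le_sum_of_cofactor_bound x y z Y
    (B := fun m₁ m₂ => δ * x / (((m₁ : ℝ) * m₂) * (1 + Real.log ((x : ℝ) + 2)) ^ 2))
    (fun m₁ m₂ => ?_) hC).trans (sum_cofactorRange_normalised_le x z hδ)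
  exact div_nonneg (mul_nonneg hδ hx0)
    (mul_nonneg (mul_nonneg (Nat.cast_nonneg _) (Nat.cast_nonneg _)) (sq_nonneg _))

/-- One-sided version: `C(m₁,m₂) ≥ -δx / (m₁m₂(1 + log(x+2))²)` on the effective range gives
`R(x) ≥ -δx`. -/
theorem neg_mul_le_twinBalancedFarSum_of_uniform_cofactor_lower (x y z Y : ℕ) {δ : ℝ}
    (hδ : 0 ≤ δ)
    (hC : ∀ m₁ ∈ Icc 1 (x / (z + 1)), ∀ m₂ ∈ Icc 1 ((x + 2) / (z + 1)),
      (Y + 1) * (m₁ * m₂) ≤ x * (x + 2) →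
      -(δ * x / (((m₁ : ℝ) * m₂) * (1 + Real.log ((x : ℝ) + 2)) ^ 2))
        ≤ twinCofactorTerm x y z Y m₁ m₂) :
    -(δ * x) ≤ twinBalancedFarSum x y z Y := by
  have hx0 : (0 : ℝ) ≤ x := Nat.cast_nonneg x
  have h := neg_sum_le_twinBalancedFarSum_of_cofactor_lower x y z Y
    (B := fun m₁ m₂ => δ * x / (((m₁ : ℝ) * m₂) * (1 + Real.log ((x : ℝ) + 2)) ^ 2))
    (fun m₁ m₂ => div_nonneg (mul_nonneg hδ hx0)
      (mul_nonneg (mul_nonneg (Nat.cast_nonneg _) (Nat.cast_nonneg _)) (sq_nonneg _))) hC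
  have h2 := sum_cofactorRange_normalised_le x z hδ
  linarith

/-! ### 5. Sufficiency, asymptotically: `R = o(x)`, Hardy–Littlewood, and tier 1 -/

section Twin

variable {ε : ℝ} {y z Y : ℕ → ℕ}

/-- **`R = o(x)` from uniform dilated pair-Chowla.**  If for every `δ > 0`, for all large `x`,
every dilated correlation on the effective range has `|C(m₁,m₂)| ≤ δx/(m₁m₂(1+log(x+2))²)`, then
the balanced far tail is `o(x)` (any cut / balance / level functions `y, z, Y`). -/
theorem twinBalancedFarSum_isLittleO_of_uniform_cofactor_bound
    (hC : ∀ δ : ℝ, 0 < δ → ∀ᶠ x : ℕ in atTop,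
      ∀ m₁ ∈ Icc 1 (x / (z x + 1)), ∀ m₂ ∈ Icc 1 ((x + 2) / (z x + 1)),
        (Y x + 1) * (m₁ * m₂) ≤ x * (x + 2) →
        |twinCofactorTerm x (y x) (z x) (Y x) m₁ m₂|
          ≤ δ * x / (((m₁ : ℝ) * m₂) * (1 + Real.log ((x : ℝ) + 2)) ^ 2)) :
    (fun x => twinBalancedFarSum x (y x) (z x) (Y x)) =o[atTop] fun x : ℕ => (x : ℝ) := by
  refine isLittleO_iff.mpr fun δ hδ => ?_
  filter_upwards [hC δ hδ] with x hx
  rw [Real.norm_eq_abs, Real.norm_eq_abs, Nat.abs_cast]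
  exact abs_twinBalancedFarSum_le_of_uniform_cofactor_bound x (y x) (z x) (Y x) hδ.le hx

/-- **Hardy–Littlewood for prime pairs from uniform dilated pair-Chowla**, under the typed prose
inputs (F′) `U = o(x)` and (F) `W = o(x)` (cut `⌊x^{1-ε}⌋`, any balance / level `z, Y`):
`π₂(x) ~ 2C₂ x / log² x`. -/
theorem hardyLittlewood_of_uniform_cofactor_bound (hε : 0 < ε) (hε1 : ε < 1)
    (hU : (fun x => twinUnbalancedSum x (rpowCut ε x) (z x)) =o[atTop] fun x : ℕ => (x : ℝ))
    (hW : (fun x => twinBalancedWindowSum x (rpowCut ε x) (z x) (Y x)) =o[atTop] fun x : ℕ => (x : ℝ))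
    (hC : ∀ δ : ℝ, 0 < δ → ∀ᶠ x : ℕ in atTop,
      ∀ m₁ ∈ Icc 1 (x / (z x + 1)), ∀ m₂ ∈ Icc 1 ((x + 2) / (z x + 1)),
        (Y x + 1) * (m₁ * m₂) ≤ x * (x + 2) →
        |twinCofactorTerm x (rpowCut ε x) (z x) (Y x) m₁ m₂|
          ≤ δ * x / (((m₁ : ℝ) * m₂) * (1 + Real.log ((x : ℝ) + 2)) ^ 2)) :
    (fun x : ℕ => (twinPrimeCount x : ℝ)) ~[atTop]
      fun x : ℕ => 2 * twinPrimeConst * x / Real.log x ^ 2 :=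
  (twinPrime_iff_balancedFarSum_isLittleO (y := rpowCut ε) (z := z) (Y := Y)
    (tendsto_rpowCut_atTop hε1) (rpowCut_mul_log_pow_isLittleO hε hε1 3) hU hW).mpr
    (twinBalancedFarSum_isLittleO_of_uniform_cofactor_bound hC)

/-- **Tier 1, one-sided, per dilation ⟹ the twin prime conjecture.**  Under (F′), (F): if for some
fixed `0 ≤ δ < 4C₂` and infinitely many `x` EVERY dilated correlation on the effective range has
`C(m₁,m₂) ≥ -δx / (m₁m₂(1 + log(x+2))²)`, then there are infinitely many twin primes. -/
theorem twinPrimeConjecture_of_frequently_cofactor_lower (hε : 0 < ε) (hε1 : ε < 1)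
    (hU : (fun x => twinUnbalancedSum x (rpowCut ε x) (z x)) =o[atTop] fun x : ℕ => (x : ℝ))
    (hW : (fun x => twinBalancedWindowSum x (rpowCut ε x) (z x) (Y x)) =o[atTop] fun x : ℕ => (x : ℝ))
    (h : ∃ δ : ℝ, 0 ≤ δ ∧ δ < 4 * twinPrimeConst ∧ ∃ᶠ x : ℕ in atTop,
      ∀ m₁ ∈ Icc 1 (x / (z x + 1)), ∀ m₂ ∈ Icc 1 ((x + 2) / (z x + 1)),
        (Y x + 1) * (m₁ * m₂) ≤ x * (x + 2) →
        -(δ * x / (((m₁ : ℝ) * m₂) * (1 + Real.log ((x : ℝ) + 2)) ^ 2))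
          ≤ twinCofactorTerm x (rpowCut ε x) (z x) (Y x) m₁ m₂) :
    TwinPrimeConjecture := by
  obtain ⟨δ, hδ0, hδ, hfr⟩ := h
  refine twinPrimeConjecture_of_frequently_twinBalancedFarSum_ge hε hε1 hU hW
    ⟨4 * twinPrimeConst - δ, by linarith, hfr.mono fun x hx => ?_⟩
  have key := neg_mul_le_twinBalancedFarSum_of_uniform_cofactor_lower x (rpowCut ε x) (z x) (Y x)
    hδ0 hx
  have : (4 * twinPrimeConst - δ - 4 * twinPrimeConst) * (x : ℝ) = -(δ * x) := by ring
  rw [this]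
  exact key

/-- The same with the prose parameters `z = ⌊x^{1/2-ε₀}⌋`, `Y = ⌊x^{1+η}⌋` (paper.md §20):
under (F′) and (F), uniform dilated pair-Chowla with saving `δ(log x)^{-4}`-of-trivial for every
`δ > 0` gives `π₂(x) ~ 2C₂x/log²x`. -/
theorem hardyLittlewood_of_uniform_cofactor_bound_rpow (hε : 0 < ε) (hε1 : ε < 1) {ε₀ η : ℝ}
    (hU : (fun x => twinUnbalancedSum x (rpowCut ε x) (balanceCut ε₀ x))
      =o[atTop] fun x : ℕ => (x : ℝ))
    (hW : (fun x => twinBalancedWindowSum x (rpowCut ε x) (balanceCut ε₀ x) (productLevel η x))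
      =o[atTop] fun x : ℕ => (x : ℝ))
    (hC : ∀ δ : ℝ, 0 < δ → ∀ᶠ x : ℕ in atTop,
      ∀ m₁ ∈ Icc 1 (x / (balanceCut ε₀ x + 1)), ∀ m₂ ∈ Icc 1 ((x + 2) / (balanceCut ε₀ x + 1)),
        (productLevel η x + 1) * (m₁ * m₂) ≤ x * (x + 2) →
        |twinCofactorTerm x (rpowCut ε x) (balanceCut ε₀ x) (productLevel η x) m₁ m₂|
          ≤ δ * x / (((m₁ : ℝ) * m₂) * (1 + Real.log ((x : ℝ) + 2)) ^ 2)) :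
    (fun x : ℕ => (twinPrimeCount x : ℝ)) ~[atTop]
      fun x : ℕ => 2 * twinPrimeConst * x / Real.log x ^ 2 :=
  hardyLittlewood_of_uniform_cofactor_bound (z := balanceCut ε₀) (Y := productLevel η) hε hε1 hU hW hC

end Twin

end Summit.Parity.BatemanHorn.Theorems
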